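import Summits.ABC.ABC.Theses.DefiniteXi
import HarnessLib

/-!
# STUB-IDEAS k2 · generation 4 — `stub_primeToSixDegreeBound` (P6), crux `DefiniteXi.SteinbergCore` (stmt-ABC-15024)
# T5 (FAMILY 2, strengthen-to-simplify): the BY-NAME RECUT of line `p6_tamagawa_split`

Playbook pattern (analytic-nt #2, IntegerScrew/ScrewPolyFloor): a `namespace Sig` skeleton whose hard stub is the
route TARGET typed BY NAME, and a composition concluding the crux BY NAME.  The only strengthening of P6 that is
(i) already a ledger item, (ii) implies P6 by a LANDED one-liner
(`Summit.ABC.ABC.Theorems.SteinbergCorePrimeRung.primeToSixDegreeBound_of_freyDegreeBound`, p162616; re-proved below as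
`p6_of_target` because that module's import chain is unbuilt on today's farm snapshot —
`remote:stale:1638:unbuilt:Summits.ABC.ABC.Theorems.DefiniteXiXiStrongBoundValuationProductBound`, rc 75 ×2) and
(iii) is implied back by P6 modulo the route's own binders (`Cruxes/SteinbergCore/AtomModuloBets.lean`;
`Theorems/DefiniteXiSteinbergCoreThesisCalibration{,Items}.lean`, p160000/p163296) is the route target
`FreyDegreeBound` (stmt-ABC-2019) itself; the same item discharges stub 3
(`Summit.ABC.ABC.Theorems.stub_abcValuationProduct_of_polyFreyDegree ∘
 Summit.ABC.ABC.Theorems.DefiniteXiPolyFreyDegree.polyFreyDegree_of_freyDegreeBound`, landed).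
So the honest two-stub form of the line is `SteinbergCore ⟸ S1 (print) ∧ S2 (target)`.

This LITE file elaborates against `Theses.DefiniteXi` alone: the split glue and the stub-3 discharge enter as the
hypotheses `hglue`, `havp` of `SteinbergCore_of`, whose dischargers are the landed constants (FULL term, to be used
verbatim once the snapshot builds the chain — file `recut_full_unbuilt.lean` in the planner folder):
  `Summit.ABC.ABC.Theorems.steinbergCore_of_subs h1
     (Summit.ABC.ABC.Theorems.SteinbergCorePrimeRung.primeToSixDegreeBound_of_freyDegreeBound hX)
     (Summit.ABC.ABC.Theorems.stub_abcValuationProduct_of_polyFreyDegree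
       (Summit.ABC.ABC.Theorems.DefiniteXiPolyFreyDegree.polyFreyDegree_of_freyDegreeBound hX))`.
Sorries: exactly the two `stub_*`.
-/

set_option linter.dupNamespace false

namespace Summit.ABC.ABC.Cruxes.SteinbergCore.StubIdeas2G4

open Summit.ABC.ABC.Theses.DefiniteXi

namespace Sig

/-- **S1 — child 1, KNOWN IN PRINT (formal debt)**: verbatim the registered `stub_xiDegreeComparison` of
`Lines/p6_tamagawa_split.lean` (Takahashi 2001 Thm 2.3 / Ribet–Takahashi 1997 / Pasten 2024 L. 6.8; landed modulo facts
p137891 / p139336 / p162272). -/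
def stub_xiDegreeComparison : Prop :=
  ∀ ε : ℝ, 0 < ε → ∃ C : ℝ, ∀ a b : ℤ, IsCoprime a b → a * b * (a + b) ≠ 0 → ∀ (N : ℕ) [NeZero N],
    (Literature.NumberTheory.EllipticCurves.freyCurve a b).conductorNorm ℤ = N →
    ∀ Nm : ℕ, Odd Nm → Squarefree Nm → Odd Nm.primeFactors.card → Nm ∣ N →
    Literature.NumberTheory.Automorphic.brandtXi (N / Nm) Nm
        (fun n => (Literature.NumberTheory.EllipticCurves.freyCurve a b).LFunction n) ≠ 0 →
    ∃ D : Literature.NumberTheory.EllipticCurves.ModularForms.ModularParametrizationData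
      (Literature.NumberTheory.EllipticCurves.freyCurve a b) N,
      (∀ D' : Literature.NumberTheory.EllipticCurves.ModularForms.ModularParametrizationData
        (Literature.NumberTheory.EllipticCurves.freyCurve a b) N, D.deg ≤ D'.deg) ∧
      ((Literature.NumberTheory.Automorphic.brandtXi (N / Nm) Nm
            (fun n => (Literature.NumberTheory.EllipticCurves.freyCurve a b).LFunction n) /
          (ordProj[2] (Literature.NumberTheory.Automorphic.brandtXi (N / Nm) Nm
              (fun n => (Literature.NumberTheory.EllipticCurves.freyCurve a b).LFunction n)) *
            ordProj[3] (Literature.NumberTheory.Automorphic.brandtXi (N / Nm) Nm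
              (fun n => (Literature.NumberTheory.EllipticCurves.freyCurve a b).LFunction n))) : ℕ) : ℝ) ≤
        C * (N : ℝ) ^ ε * ((D.deg / (ordProj[2] D.deg * ordProj[3] D.deg) : ℕ) : ℝ) *
          ((∏ q ∈ N.primeFactors, ((Literature.NumberTheory.EllipticCurves.freyCurve a b).minimalDiscriminantNorm
            ℤ).factorization q : ℕ) : ℝ) ^ 3

/-- **S2 — the route TARGET by name** (rank-0 item stmt-ABC-2019: Frey's degree conjecture on Frey–Hellegouarch curves). -/
def stub_freyDegreeBound : Prop :=
  Summit.ABC.ABC.Theses.DefiniteXi.FreyDegreeBound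

/-- The registered stub 2 (P6) of `Lines/p6_tamagawa_split.lean`, verbatim — here a DERIVED quantity, not a stub. -/
def P6 : Prop :=
  ∀ ε : ℝ, 0 < ε → ∃ C : ℝ, ∀ a b : ℤ, IsCoprime a b → a * b * (a + b) ≠ 0 → ∀ (N : ℕ) [NeZero N],
    (Literature.NumberTheory.EllipticCurves.freyCurve a b).conductorNorm ℤ = N →
    ∀ D : Literature.NumberTheory.EllipticCurves.ModularForms.ModularParametrizationData
      (Literature.NumberTheory.EllipticCurves.freyCurve a b) N,
      (∀ D' : Literature.NumberTheory.EllipticCurves.ModularForms.ModularParametrizationData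
        (Literature.NumberTheory.EllipticCurves.freyCurve a b) N, D.deg ≤ D'.deg) →
      ((D.deg / (ordProj[2] D.deg * ordProj[3] D.deg) : ℕ) : ℝ) ≤ C * (N : ℝ) ^ (2 + ε)

/-- The registered stub 3 of `Lines/p6_tamagawa_split.lean` (= stmt-ABC-1567 `AbcValuationProduct`), verbatim — here
DERIVED from S2 (landed `stub_abcValuationProduct_of_polyFreyDegree ∘ polyFreyDegree_of_freyDegreeBound`), not a stub. -/
def AVP : Prop :=
  ∀ ε : ℝ, 0 < ε → ∃ K : ℝ, ∀ a b c : ℕ, Literature.NumberTheory.DiophantineGeometry.IsABCTriple a b c →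
    ((∏ p ∈ (a * b * c).primeFactors, (a * b * c).factorization p : ℕ) : ℝ) ≤
      K * ((Literature.NumberTheory.DiophantineGeometry.rad a b c : ℕ) : ℝ) ^ ε

end Sig

/-- The two `Sig` statements are the registered line's stub 1 and the route file's target, definitionally. -/
example : Sig.stub_freyDegreeBound ↔ FreyDegreeBound := Iff.rfl

/-- Stub S1 (print formal debt; its prime-type instance is one Literature fact away, p162272). -/
theorem stub_xiDegreeComparison : Sig.stub_xiDegreeComparison := by
  sorry

/-- Stub S2 = the route target BY NAME. -/
theorem stub_freyDegreeBound : Sig.stub_freyDegreeBound := by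
  sorry

/-- **H1 — the target gives P6** (tree: `SteinbergCorePrimeRung.primeToSixDegreeBound_of_freyDegreeBound`, p162616;
re-proved since that module is unbuilt on today's snapshot): a minimal datum has degree ≤ the degree of the datum the
target provides, and `cps n ≤ n`. [folklore] -/
theorem p6_of_target (hX : Sig.stub_freyDegreeBound) : Sig.P6 := by
  intro ε hε
  obtain ⟨C, hC⟩ := hX ε hε
  refine ⟨C, fun a b hab h0 N _ hN D hDmin => ?_⟩
  obtain ⟨D₀, hD₀⟩ := hC a b hab h0 N hN
  have h1 : (D.deg : ℝ) ≤ (D₀.deg : ℝ) := by exact_mod_cast hDmin D₀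
  have h2 : ((D.deg / (ordProj[2] D.deg * ordProj[3] D.deg) : ℕ) : ℝ) ≤ (D.deg : ℝ) := by
    exact_mod_cast Nat.div_le_self _ _
  exact h2.trans (h1.trans hD₀)

/-- **H1′ — the target gives the weak rung** (tree: `DefiniteXiPolyFreyDegree.polyFreyDegree_of_freyDegreeBound`, landed;
copied): `ε = 1`, `A = 3`.  With the landed `stub_abcValuationProduct_of_polyFreyDegree` this discharges `havp` below. [folklore] -/
theorem polyFreyDegree_of_target (hX : Sig.stub_freyDegreeBound) : PolyFreyDegree := by
  obtain ⟨C, hC⟩ := hX 1 one_pos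
  exact ⟨2 + 1, C, hC⟩

/-- **Composition BY NAME.**  `hglue` := `Summit.ABC.ABC.Theorems.steinbergCore_of_subs` (p137293, the registered line's
`SteinbergCore_of`); `havp` := `fun h => Summit.ABC.ABC.Theorems.stub_abcValuationProduct_of_polyFreyDegree
(polyFreyDegree_of_target h)` (p160000).  Both are landed constants (import chain unbuilt today, hence binders). -/
theorem SteinbergCore_of
    (hglue : Sig.stub_xiDegreeComparison → Sig.P6 → Sig.AVP → Summit.ABC.ABC.Theses.DefiniteXi.SteinbergCore)
    (havp : PolyFreyDegree → Sig.AVP)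
    (h1 : Sig.stub_xiDegreeComparison) (hX : Sig.stub_freyDegreeBound) :
    Summit.ABC.ABC.Theses.DefiniteXi.SteinbergCore :=
  hglue h1 (p6_of_target hX) (havp (polyFreyDegree_of_target hX))

end Summit.ABC.ABC.Cruxes.SteinbergCore.StubIdeas2G4
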